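import Summits.ResolutionOfSingularities.ResolutionOfSingularities.Theorems.FrobeniusLadderFInjectiveMacaulayficationX2FormPointFloor
import Summits.ResolutionOfSingularities.ResolutionOfSingularities.Theorems.FrobeniusLadderFInjectiveMacaulayficationPinchFloorFull
import Summits.ResolutionOfSingularities.ResolutionOfSingularities.Theorems.FrobeniusLadderFInjectiveMacaulayficationGermFullOfModel
import HarnessLib

/-!
# THE POINT FLOOR OF THE QUARTIC DOUBLE POINT `x² + F₄` IS FULL AT EVERY STALK FOR EVERY ODD `p` (pinch charts `X₄² + X_a²·W_a`, `V(W_a)` pointwise smooth): `Bl_𝔪 Y` FULL everywhere,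
# every blowing up of `Spec 𝒪_{Y,v}` along the point floor LEGAL ∧ FULL, and the germ form `FInjectivizationGermAt p v`
# (crux `FInjectiveMacaulayfication` stmt-ResolutionOfSingularities-15315, chain w45a; this seat's TAKING line 01:30Z (β″) — FILE Q1, consumed by the p = 3 quartic F-side class row
# `…X2QuarticFSideChar3` and usable by habitat #3a; seat res-L1-w45a-stub-1 g14; engines: res-L1-w45a-lead-1's ✓ `PinchFloorFull.clause_pinch_smooth` (p683974),
# ✓ `GermOfGlobalBlowup.hypersurfacePointBlowup_fullCl`, ✓ `PointFloorLegalOfIsolated`; charts ✓ `X2FormPointFloor`)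

[OURS · L1 W4.5a] Support file (`--supports stmt-ResolutionOfSingularities-15315 --as helper`); def-free; UNCONDITIONAL; no named fact; NOT a statement of any manuscript. A FULLness /
legality package; nothing of the crux is proved. AI-written (AI review is weaker than expert review).

* §1 `G_sq_ne_zero`, ★ `clause_every_chart_pinch` (odd `p`): the `hpts` clause for the five charts of `Bl_𝔪 Y`, `Y = {x² + F₄}` — charts `a ≤ 3` are PINCH charts
  `X₄² + X_a²·W_a` (`W_a = F₄|_{Y_a=1}` renamed), FULL at every closed point by ✓ `clause_pinch_smooth` when `V(W_a)` is pointwise smooth; the `x`-chart `1 + X₄²·F` has no point over `v`.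
* §2 `F_ne_zero_of_smooth`, ★★ `affineBlowup_fullCl_quartic` (odd `p`; `f` prime, `Y` regular off `v`, smooth dehomogenisations): `Bl_𝔪 Y` FULL at EVERY point;
  ★ `pointFloor_legal_full_quartic` (every blowing up of `Spec 𝒪_{Y,v}` along the point floor: LEGAL ∧ FULL at every stalk); ★ `fInjectivizationGermAt_quartic` (the germ form, every odd `p`).
[folklore mathematics, OURS as a certificate; cite: Fedder1983, Thm. 1.12; GortzWedhorn2020, Prop. 13.91 (2); StacksProject, Tag 0804; Kollar2007, §2.5]
-/

-- single-problem summit: the doubled namespace component is forced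
set_option linter.dupNamespace false

noncomputable section

namespace Summit.ResolutionOfSingularities.ResolutionOfSingularities.Theorems.FInjectiveMacaulayfication.X2QuarticPointFloor

open CategoryTheory CategoryTheory.Limits AlgebraicGeometry TopologicalSpace IsLocalRing MvPolynomial
open Literature.AlgebraicGeometry.Resolution
open Summit.ResolutionOfSingularities.ResolutionOfSingularities.Theorems.FInjectiveMacaulayfication
open SliceableCentre GermForm GermOfGlobalBlowup X2FormPointFloor

variable (k : Type) [Field k]

/-! ## §1 The `hpts` clause for the pinch charts -/

/-- `X₄² + X_a²·W ≠ 0` for `a ≠ 4` (evaluate at `e₄`). [elementary] -/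
theorem G_sq_ne_zero (a : Fin 5) (ha : a ≠ 4) (W G : MvPolynomial (Fin 5) k) (hG : G = X 4 ^ 2 + X a ^ 2 * W) : G ≠ 0 := by
  intro h0
  have := congrArg (MvPolynomial.eval (Pi.single 4 1 : Fin 5 → k)) h0
  rw [hG] at this
  simp [ha] at this

/-- ★ **`hpts` for the five charts of `Bl_𝔪 Y`, `Y = {x² + F₄}`, every ODD `p`**: the FULL clause at every maximal ideal `Q ∋ x̄ᵢ` of each chart ring — the four pinch charts
`X₄² + X_a²·W_a` by lead-1's ✓ `PinchFloorFull.clause_pinch_smooth` (at EVERY maximal ideal, given `V(W_a)` pointwise smooth), the `x`-chart `1 + X₄²·q` vacuously. [OURS · assembly] -/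
theorem clause_every_chart_pinch (p : ℕ) [Fact p.Prime] [CharP k p] (hp2 : p ≠ 2) (G : Fin 5 → MvPolynomial (Fin 5) k) (w : Fin 4 → MvPolynomial (Fin 3) k)
    (hGw : ∀ a : Fin 4, G (Fin.castSucc a) = X 4 ^ 2 + X (Fin.castSucc a) ^ 2 * rename ((![![1, 2, 3], ![0, 2, 3], ![0, 1, 3], ![0, 1, 2]] : Fin 4 → Fin 3 → Fin 5) a) (w a))
    (hws : ∀ (a : Fin 4) (Q : Ideal (MvPolynomial (Fin 3) k)), Q.IsPrime → w a ∈ Q → ∃ D : Derivation k (MvPolynomial (Fin 3) k) (MvPolynomial (Fin 3) k), D (w a) ∉ Q)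
    (q : MvPolynomial (Fin 5) k) (hG4 : G 4 = 1 + X 4 ^ 2 * q) :
    ∀ (i : Fin 5) (Q : Ideal (MvPolynomial (Fin 5) k ⧸ Ideal.span {G i})) [Q.IsMaximal],
      Ideal.Quotient.mk _ (X i) ∈ Q →
      ∀ d : ℕ, ringKrullDim (Localization.AtPrime Q) = d → ∀ s : Fin d → Localization.AtPrime Q,
        (Ideal.span (Set.range s)).radical.IsMaximal →
          RingTheory.Sequence.IsWeaklyRegular (Localization.AtPrime Q) (List.ofFn s) ∧
          ∀ y : Localization.AtPrime Q, (∃ e : ℕ, y ^ p ^ e ∈ Ideal.span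
            ((fun z : Localization.AtPrime Q => z ^ p ^ e) ''
              (Ideal.span (Set.range s) : Set (Localization.AtPrime Q)))) → y ∈ Ideal.span (Set.range s) := by
  have hsing : ∀ (a : Fin 4) (Q : Ideal (MvPolynomial (Fin 5) k ⧸ Ideal.span {G (Fin.castSucc a)})) [Q.IsMaximal],
      ∀ d : ℕ, ringKrullDim (Localization.AtPrime Q) = d → ∀ s : Fin d → Localization.AtPrime Q,
        (Ideal.span (Set.range s)).radical.IsMaximal →
          RingTheory.Sequence.IsWeaklyRegular (Localization.AtPrime Q) (List.ofFn s) ∧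
          ∀ y : Localization.AtPrime Q, (∃ e : ℕ, y ^ p ^ e ∈ Ideal.span
            ((fun z : Localization.AtPrime Q => z ^ p ^ e) ''
              (Ideal.span (Set.range s) : Set (Localization.AtPrime Q)))) → y ∈ Ideal.span (Set.range s) := by
    intro a Q hQ
    have ha4 : Fin.castSucc a ≠ (4 : Fin 5) := (Fin.castSucc_lt_last a).ne
    have he_inj : Function.Injective ((![![1, 2, 3], ![0, 2, 3], ![0, 1, 3], ![0, 1, 2]] : Fin 4 → Fin 3 → Fin 5) a) := by
      fin_cases a <;> decide
    have he_a : ∀ j, ((![![1, 2, 3], ![0, 2, 3], ![0, 1, 3], ![0, 1, 2]] : Fin 4 → Fin 3 → Fin 5) a) j ≠ Fin.castSucc a := by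
      fin_cases a <;> decide
    have he_4 : ∀ j, ((![![1, 2, 3], ![0, 2, 3], ![0, 1, 3], ![0, 1, 2]] : Fin 4 → Fin 3 → Fin 5) a) j ≠ 4 := by
      fin_cases a <;> decide
    exact PinchFloorFull.clause_pinch_smooth k p hp2 (Fin.castSucc a) ha4 _ _ (hGw a) (X2CubicFormTStepRow.pderiv_rename_eq_zero k _ _ (he_a) (w a))
      (X2CubicFormTStepRow.pderiv_rename_eq_zero k _ _ (he_4) (w a)) (G_sq_ne_zero k _ ha4 _ _ (hGw a))
      (X2CubicFormTStepRow.smooth_rename k _ he_inj (w a) (hws a)) Q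
  intro i Q hQ hXi
  by_cases hi : i = 4
  · subst hi
    have hG4' : G 4 = 1 + X 4 * (X 4 * q) := by rw [hG4]; ring
    exact absurd hXi (X2Cubic4FloorFullCert.chartFour_X_not_mem k (G 4) (X 4 * q) hG4' Q (Ideal.IsMaximal.ne_top hQ))
  · have : i = Fin.castSucc (i.castPred hi) := (Fin.castSucc_castPred i hi).symm
    revert Q
    rw [this]
    intro Q hQ _
    exact hsing (i.castPred hi) Q

/-! ## §2 ★★ The point floor of `x² + F₄` is FULL at every stalk, every odd `p` -/

/-- `F ≠ 0` follows from the smoothness hypothesis (a derivation never takes `0` outside a prime). [plumbing] -/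
theorem F_ne_zero_of_smooth (F : MvPolynomial (Fin 4) k)
    (hws : ∀ (a : Fin 4) (Q : Ideal (MvPolynomial (Fin 3) k)), Q.IsPrime →
      MvPolynomial.aeval ((![![1, X 0, X 1, X 2], ![X 0, 1, X 1, X 2], ![X 0, X 1, 1, X 2], ![X 0, X 1, X 2, 1]] : Fin 4 → Fin 4 → MvPolynomial (Fin 3) k) a) F ∈ Q →
      ∃ D : Derivation k (MvPolynomial (Fin 3) k) (MvPolynomial (Fin 3) k),
        D (MvPolynomial.aeval ((![![1, X 0, X 1, X 2], ![X 0, 1, X 1, X 2], ![X 0, X 1, 1, X 2], ![X 0, X 1, X 2, 1]] : Fin 4 → Fin 4 → MvPolynomial (Fin 3) k) a) F) ∉ Q) :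
    F ≠ 0 := by
  intro h0
  obtain ⟨D, hD⟩ := hws 0 ⊥ Ideal.isPrime_bot (by rw [h0, map_zero]; exact Ideal.zero_mem _)
  rw [h0, map_zero, map_zero] at hD
  exact hD (Ideal.zero_mem _)

/-- ★★ **`Bl_𝔪 Y` IS FULL AT EVERY POINT for `Y = {x² + F₄}`, every ODD prime `p`** (`F₄` a quartic form; `f` prime; `Y` regular off the vertex; the four dehomogenisations of `F₄` with
pointwise-smooth zero locus): the singular charts are pinch charts. [OURS · assembly; cite: Fedder1983, Thm. 1.12; StacksProject, Tag 0804] -/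
theorem affineBlowup_fullCl_quartic (p : ℕ) [Fact p.Prime] [CharP k p] (hp2 : p ≠ 2) (F : MvPolynomial (Fin 4) k) (hF : F.IsHomogeneous 4) (f : MvPolynomial (Fin 5) k)
    (hf : f = X 4 ^ 2 + rename (Fin.castSucc : Fin 4 → Fin 5) F) (hprime : Prime f)
    (hoff : ∀ (P : Ideal (MvPolynomial (Fin 5) k ⧸ Ideal.span {f})) [P.IsPrime],
      ¬ Ideal.span (Set.range fun j : Fin 5 => Ideal.Quotient.mk (Ideal.span {f}) (X j)) ≤ P → IsRegularLocalRing (Localization.AtPrime P))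
    (hws : ∀ (a : Fin 4) (Q : Ideal (MvPolynomial (Fin 3) k)), Q.IsPrime →
      MvPolynomial.aeval ((![![1, X 0, X 1, X 2], ![X 0, 1, X 1, X 2], ![X 0, X 1, 1, X 2], ![X 0, X 1, X 2, 1]] : Fin 4 → Fin 4 → MvPolynomial (Fin 3) k) a) F ∈ Q →
      ∃ D : Derivation k (MvPolynomial (Fin 3) k) (MvPolynomial (Fin 3) k),
        D (MvPolynomial.aeval ((![![1, X 0, X 1, X 2], ![X 0, 1, X 1, X 2], ![X 0, X 1, 1, X 2], ![X 0, X 1, X 2, 1]] : Fin 4 → Fin 4 → MvPolynomial (Fin 3) k) a) F) ∉ Q) :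
    ∀ y : ↥(affineBlowup (Ideal.span (Set.range fun j : Fin 5 => Ideal.Quotient.mk (Ideal.span {f}) (X j)))),
      FullCl p ((affineBlowup (Ideal.span (Set.range fun j : Fin 5 => Ideal.Quotient.mk (Ideal.span {f}) (X j)))).presheaf.stalk y) := by
  haveI hfprime : (Ideal.span {f}).IsPrime := (Ideal.span_singleton_prime hprime.ne_zero).mpr hprime
  have hF0 : F ≠ 0 := F_ne_zero_of_smooth k F hws
  obtain ⟨G, hG⟩ : ∃ G : Fin 5 → MvPolynomial (Fin 5) k, G = fun i : Fin 5 =>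
      if h : i = 4 then 1 + X 4 ^ 2 * rename (Fin.castSucc : Fin 4 → Fin 5) F
      else X 4 ^ 2 + X i ^ 2 * rename ((![![1, 2, 3], ![0, 2, 3], ![0, 1, 3], ![0, 1, 2]] : Fin 4 → Fin 3 → Fin 5) (i.castPred h))
        (MvPolynomial.aeval ((![![1, X 0, X 1, X 2], ![X 0, 1, X 1, X 2], ![X 0, X 1, 1, X 2], ![X 0, X 1, X 2, 1]] :
          Fin 4 → Fin 4 → MvPolynomial (Fin 3) k) (i.castPred h)) F) := ⟨_, rfl⟩
  have hG4 : G 4 = 1 + X 4 ^ 2 * rename (Fin.castSucc : Fin 4 → Fin 5) F := by rw [hG]; simp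
  have hGw : ∀ a : Fin 4, G (Fin.castSucc a) = X 4 ^ 2 + X (Fin.castSucc a) ^ 2 *
      rename ((![![1, 2, 3], ![0, 2, 3], ![0, 1, 3], ![0, 1, 2]] : Fin 4 → Fin 3 → Fin 5) a)
        (MvPolynomial.aeval ((![![1, X 0, X 1, X 2], ![X 0, 1, X 1, X 2], ![X 0, X 1, 1, X 2], ![X 0, X 1, X 2, 1]] :
          Fin 4 → Fin 4 → MvPolynomial (Fin 3) k) a) F) := by
    intro a
    have ha4 : Fin.castSucc a ≠ (4 : Fin 5) := (Fin.castSucc_lt_last a).ne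
    rw [hG]
    dsimp only
    rw [dif_neg ha4, Fin.castPred_castSucc]
  have hθ : ∀ i : Fin 5, MvPolynomial.aeval (fun j : Fin 5 => if j = i then (X i : MvPolynomial (Fin 5) k) else X j * X i) f = X i ^ 2 * G i := by
    intro i
    by_cases hi : i = 4
    · subst hi; rw [hG4]; exact theta_four_deg k 4 (by norm_num) F hF f hf
    · have : i = Fin.castSucc (i.castPred hi) := (Fin.castSucc_castPred i hi).symm
      rw [this, hGw]
      exact theta_castSucc_deg k 4 (by norm_num) F hF f hf _
  have hGX : ∀ i : Fin 5, G i ∉ Ideal.span {(X i : MvPolynomial (Fin 5) k)} := by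
    intro i
    by_cases hi : i = 4
    · subst hi; exact one_add_X_pow_mul_not_mem_span_X k 2 (by norm_num) _ (G 4) hG4
    · have : i = Fin.castSucc (i.castPred hi) := (Fin.castSucc_castPred i hi).symm
      rw [this]
      exact X_sq_add_X_pow_mul_not_mem_span_X k _ (Fin.castSucc_lt_last _).ne 2 (by norm_num) _ _ (hGw _)
  exact hypersurfacePointBlowup_fullCl p k 5 (by norm_num) f G 2 hfprime hθ (f_not_mem_span_X_deg k 4 (by norm_num) F hF hF0 f hf) hGX
    (fun P _ hP => hoff P hP) (clause_every_chart_pinch k p hp2 G _ hGw hws _ hG4)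

/-- ★ **Every blowing up of `Spec 𝒪_{Y,v}` along the point floor of `Y = {x² + F₄}` is LEGAL and FULL at every stalk** (odd `p`, same hypotheses). [OURS · assembly;
cite: GortzWedhorn2020, Prop. 13.91 (2)] -/
theorem pointFloor_legal_full_quartic (p : ℕ) [Fact p.Prime] [CharP k p] (hp2 : p ≠ 2) (F : MvPolynomial (Fin 4) k) (hF : F.IsHomogeneous 4) (f : MvPolynomial (Fin 5) k)
    (hf : f = X 4 ^ 2 + rename (Fin.castSucc : Fin 4 → Fin 5) F) (hprime : Prime f)
    (hoff : ∀ (P : Ideal (MvPolynomial (Fin 5) k ⧸ Ideal.span {f})) [P.IsPrime],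
      ¬ Ideal.span (Set.range fun j : Fin 5 => Ideal.Quotient.mk (Ideal.span {f}) (X j)) ≤ P → IsRegularLocalRing (Localization.AtPrime P))
    (hws : ∀ (a : Fin 4) (Q : Ideal (MvPolynomial (Fin 3) k)), Q.IsPrime →
      MvPolynomial.aeval ((![![1, X 0, X 1, X 2], ![X 0, 1, X 1, X 2], ![X 0, X 1, 1, X 2], ![X 0, X 1, X 2, 1]] : Fin 4 → Fin 4 → MvPolynomial (Fin 3) k) a) F ∈ Q →
      ∃ D : Derivation k (MvPolynomial (Fin 3) k) (MvPolynomial (Fin 3) k),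
        D (MvPolynomial.aeval ((![![1, X 0, X 1, X 2], ![X 0, 1, X 1, X 2], ![X 0, X 1, 1, X 2], ![X 0, X 1, X 2, 1]] : Fin 4 → Fin 4 → MvPolynomial (Fin 3) k) a) F) ∉ Q)
    (v : Spec (.of (MvPolynomial (Fin 5) k ⧸ Ideal.span {f})))
    (hv : v.asIdeal = Ideal.span (Set.range fun j : Fin 5 => Ideal.Quotient.mk (Ideal.span {f}) (X j))) :
    ∀ (S' : Scheme.{0}) (g : S' ⟶ Spec ((Spec (.of (MvPolynomial (Fin 5) k ⧸ Ideal.span {f}))).presheaf.stalk v)),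
      IsBlowup g ((affineBlowup.idealSheaf (Ideal.span (Set.range (fun j : Fin 5 => Ideal.Quotient.mk (Ideal.span {f}) (X j))))).comap
        ((Spec (.of (MvPolynomial (Fin 5) k ⧸ Ideal.span {f}))).fromSpecStalk v)) →
      (((affineBlowup.idealSheaf (Ideal.span (Set.range (fun j : Fin 5 => Ideal.Quotient.mk (Ideal.span {f}) (X j))))).comap
          ((Spec (.of (MvPolynomial (Fin 5) k ⧸ Ideal.span {f}))).fromSpecStalk v)) ≠ ⊥ ∧
        (((((affineBlowup.idealSheaf (Ideal.span (Set.range (fun j : Fin 5 => Ideal.Quotient.mk (Ideal.span {f}) (X j))))).comap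
            ((Spec (.of (MvPolynomial (Fin 5) k ⧸ Ideal.span {f}))).fromSpecStalk v))).support :
              Set (Spec ((Spec (.of (MvPolynomial (Fin 5) k ⧸ Ideal.span {f}))).presheaf.stalk v))) ⊆
            (Scheme.regularLocus (Spec ((Spec (.of (MvPolynomial (Fin 5) k ⧸ Ideal.span {f}))).presheaf.stalk v)))ᶜ) ∧
        (∀ s : S', g.base s ≠ closedPoint ((Spec (.of (MvPolynomial (Fin 5) k ⧸ Ideal.span {f}))).presheaf.stalk v) → s ∈ Scheme.regularLocus S') ∧
        (∀ s : S', CMCl (S'.presheaf.stalk s))) ∧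
      (∀ s : S', FullCl p (S'.presheaf.stalk s)) := by
  intro S' g hg
  have hF0 : F ≠ 0 := F_ne_zero_of_smooth k F hws
  have hreg : ∀ y : Spec (.of (MvPolynomial (Fin 5) k ⧸ Ideal.span {f})), y ⤳ v → y ≠ v →
      y ∈ Scheme.regularLocus (Spec (.of (MvPolynomial (Fin 5) k ⧸ Ideal.span {f}))) := by
    intro y hy hne
    refine FermatCubicConeGerm.mem_regularLocus_Spec_of_isRegularLocalRing y (hoff y.asIdeal fun hle => hne ?_)
    have hyv : y.asIdeal ≤ v.asIdeal := (PrimeSpectrum.le_iff_specializes y v).mpr hy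
    exact PrimeSpectrum.ext (le_antisymm hyv (hv ▸ hle))
  -- the explicit strict transforms once more, for the legality engine
  obtain ⟨G, hG⟩ : ∃ G : Fin 5 → MvPolynomial (Fin 5) k, G = fun i : Fin 5 =>
      if h : i = 4 then 1 + X 4 ^ 2 * rename (Fin.castSucc : Fin 4 → Fin 5) F
      else X 4 ^ 2 + X i ^ 2 * rename ((![![1, 2, 3], ![0, 2, 3], ![0, 1, 3], ![0, 1, 2]] : Fin 4 → Fin 3 → Fin 5) (i.castPred h))
        (MvPolynomial.aeval ((![![1, X 0, X 1, X 2], ![X 0, 1, X 1, X 2], ![X 0, X 1, 1, X 2], ![X 0, X 1, X 2, 1]] :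
          Fin 4 → Fin 4 → MvPolynomial (Fin 3) k) (i.castPred h)) F) := ⟨_, rfl⟩
  have hG4 : G 4 = 1 + X 4 ^ 2 * rename (Fin.castSucc : Fin 4 → Fin 5) F := by rw [hG]; simp
  have hGw : ∀ a : Fin 4, G (Fin.castSucc a) = X 4 ^ 2 + X (Fin.castSucc a) ^ 2 *
      rename ((![![1, 2, 3], ![0, 2, 3], ![0, 1, 3], ![0, 1, 2]] : Fin 4 → Fin 3 → Fin 5) a)
        (MvPolynomial.aeval ((![![1, X 0, X 1, X 2], ![X 0, 1, X 1, X 2], ![X 0, X 1, 1, X 2], ![X 0, X 1, X 2, 1]] :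
          Fin 4 → Fin 4 → MvPolynomial (Fin 3) k) a) F) := by
    intro a
    have ha4 : Fin.castSucc a ≠ (4 : Fin 5) := (Fin.castSucc_lt_last a).ne
    rw [hG]
    dsimp only
    rw [dif_neg ha4, Fin.castPred_castSucc]
  have hθ : ∀ i : Fin 5, MvPolynomial.aeval (fun j : Fin 5 => if j = i then (X i : MvPolynomial (Fin 5) k) else X j * X i) f =
      X i ^ ((fun _ : Fin 5 => 2) i) * G i := by
    intro i
    dsimp only
    by_cases hi : i = 4
    · subst hi; rw [hG4]; exact theta_four_deg k 4 (by norm_num) F hF f hf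
    · have : i = Fin.castSucc (i.castPred hi) := (Fin.castSucc_castPred i hi).symm
      rw [this, hGw]
      exact theta_castSucc_deg k 4 (by norm_num) F hF f hf _
  have hGX : ∀ i : Fin 5, G i ∉ Ideal.span {(X i : MvPolynomial (Fin 5) k)} := by
    intro i
    by_cases hi : i = 4
    · subst hi; exact one_add_X_pow_mul_not_mem_span_X k 2 (by norm_num) _ (G 4) hG4
    · have : i = Fin.castSucc (i.castPred hi) := (Fin.castSucc_castPred i hi).symm
      rw [this]
      exact X_sq_add_X_pow_mul_not_mem_span_X k _ (Fin.castSucc_lt_last _).ne 2 (by norm_num) _ _ (hGw _)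
  have hscope := vertex_closed_singular_deg k 4 (by norm_num) F hF f hf hprime v hv
  exact ⟨PointFloorLegalOfIsolated.pointFloor_input_legal k f hprime (by norm_num) (fun _ : Fin 5 => 2) G hθ (f_not_mem_span_X_deg k 4 (by norm_num) F hF hF0 f hf) hGX v hv
      hscope.2.1 hreg S' g hg,
    GermFullOfModel.forall_isBlowup_germ_fullCl_of_affineBlowup p _ v (affineBlowup_fullCl_quartic k p hp2 F hF f hf hprime hoff hws) S' g hg⟩

/-- ★ **THE GERM FORM, every odd `p`**: `FInjectivizationGermAt p v` at the vertex of `Y = {x² + F₄}` (same hypotheses) — the witness centre is the point floor, the model `Bl_𝔪 Y`.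
[folklore glue; cite: GortzWedhorn2020, Prop. 13.91 (2)] -/
theorem fInjectivizationGermAt_quartic (p : ℕ) [Fact p.Prime] [CharP k p] (hp2 : p ≠ 2) (F : MvPolynomial (Fin 4) k) (hF : F.IsHomogeneous 4) (f : MvPolynomial (Fin 5) k)
    (hf : f = X 4 ^ 2 + rename (Fin.castSucc : Fin 4 → Fin 5) F) (hprime : Prime f)
    (hoff : ∀ (P : Ideal (MvPolynomial (Fin 5) k ⧸ Ideal.span {f})) [P.IsPrime],
      ¬ Ideal.span (Set.range fun j : Fin 5 => Ideal.Quotient.mk (Ideal.span {f}) (X j)) ≤ P → IsRegularLocalRing (Localization.AtPrime P))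
    (hws : ∀ (a : Fin 4) (Q : Ideal (MvPolynomial (Fin 3) k)), Q.IsPrime →
      MvPolynomial.aeval ((![![1, X 0, X 1, X 2], ![X 0, 1, X 1, X 2], ![X 0, X 1, 1, X 2], ![X 0, X 1, X 2, 1]] : Fin 4 → Fin 4 → MvPolynomial (Fin 3) k) a) F ∈ Q →
      ∃ D : Derivation k (MvPolynomial (Fin 3) k) (MvPolynomial (Fin 3) k),
        D (MvPolynomial.aeval ((![![1, X 0, X 1, X 2], ![X 0, 1, X 1, X 2], ![X 0, X 1, 1, X 2], ![X 0, X 1, X 2, 1]] : Fin 4 → Fin 4 → MvPolynomial (Fin 3) k) a) F) ∉ Q)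
    (v : Spec (.of (MvPolynomial (Fin 5) k ⧸ Ideal.span {f})))
    (hv : v.asIdeal = Ideal.span (Set.range fun j : Fin 5 => Ideal.Quotient.mk (Ideal.span {f}) (X j))) :
    FInjectivizationGermAt p v := by
  haveI hfprime : (Ideal.span {f}).IsPrime := (Ideal.span_singleton_prime hprime.ne_zero).mpr hprime
  haveI : IsDomain (MvPolynomial (Fin 5) k ⧸ Ideal.span {f}) := Ideal.Quotient.isDomain _
  have hF0 : F ≠ 0 := F_ne_zero_of_smooth k F hws
  have hXf : (X 4 : MvPolynomial (Fin 5) k) ∉ Ideal.span {f} :=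
    PrimeTransfer.X_not_mem_span_of_isPrime hfprime (f_not_mem_span_X_deg k 4 (by norm_num) F hF hF0 f hf 4)
  have hI : Ideal.span (Set.range fun j : Fin 5 => Ideal.Quotient.mk (Ideal.span {f}) (X j)) ≠ ⊥ := fun hbot =>
    hXf (Ideal.Quotient.eq_zero_iff_mem.mp ((Ideal.mem_bot).mp (hbot ▸ Ideal.subset_span (Set.mem_range_self (4 : Fin 5)))))
  exact fInjectivizationGermAt_of_affineBlowup p _ hI v (hv ▸ Ideal.le_radical) (affineBlowup_fullCl_quartic k p hp2 F hF f hf hprime hoff hws)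


end Summit.ResolutionOfSingularities.ResolutionOfSingularities.Theorems.FInjectiveMacaulayfication.X2QuarticPointFloor

end
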